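import Mathlib
import Summits.ValiantsHypothesis.ValiantsHypothesis.Theorems.ProofCarryingSymmetryRestorationQPACFlatten

/-!
# Route ProofCarryingSymmetry — crux `RestorationQP`, line `registered`, rung S3⁗ under stub S2″ (`stub_proofsToACEquiv`), part 2:
a sum is determined modulo AC by the multiset of its flattened summands

Continuation of `…RestorationQPACFlatten.lean` (`addArgs`, `mulArgs`, `ACClass`).  Part 2 of the
cycle-1 development proved that AC-equivalent formulas have the same multiset of AC-classes of
flattened summands (`ACEq.addArgs_map_mk_eq`).  This file proves the CONVERSE, needed by the constant
folding normaliser of rung S3⁗ (parts 3–5): if the flattened summands of `F` and `G` have the same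
classes with multiplicity, then `ACEq F G` (`acEq_of_addArgs_perm`), and likewise for factors
(`acEq_of_mulArgs_perm`).  The proof goes through the quotient: `+` descends to a commutative and
associative operation `addC` on classes, so the left-nested sum `sumL u us = u + u₁ + ⋯ + u_k` of a
list has a class depending only on the multiset of classes (`acEq_sumL_of_perm`, via
`List.Perm.foldl_eq`), and every formula is AC-equivalent to the left-nested sum of its flattened
summands (`acEq_sumL_addArgs`).

Everything is elementary and proved; no named facts.
-/

-- single-problem summit: `Summit.ValiantsHypothesis.ValiantsHypothesis.…` is the namespace by design (D-0017)
set_option linter.dupNamespace false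

namespace Summit.ValiantsHypothesis.ValiantsHypothesis.Theorems

namespace ACStability

open Literature.Computability.AlgebraicComplexity ACClass

universe u v

variable {𝔽 : Type u} {X : Type v}

/-! ### Sums -/

/-- The left-nested sum `u + u₁ + ⋯ + u_k` of a nonempty list `u :: us`. [folklore] -/
def sumL (u : PIFormula 𝔽 X) (us : List (PIFormula 𝔽 X)) : PIFormula 𝔽 X := us.foldl .add u

/-- `sumL` of a singleton. [folklore] -/
@[simp] theorem sumL_nil (u : PIFormula 𝔽 X) : sumL u [] = u := rfl

/-- `sumL` unfolds one step. [folklore] -/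
@[simp] theorem sumL_cons (u w : PIFormula 𝔽 X) (ws : List (PIFormula 𝔽 X)) :
    sumL u (w :: ws) = sumL (.add u w) ws := rfl

/-- `sumL` over a concatenation. [folklore] -/
theorem sumL_append (u : PIFormula 𝔽 X) (us : List (PIFormula 𝔽 X)) (v : PIFormula 𝔽 X)
    (vs : List (PIFormula 𝔽 X)) : sumL u (us ++ v :: vs) = sumL (.add (sumL u us) v) vs := by
  simp only [sumL, List.foldl_append, List.foldl_cons]

/-- `sumL` respects AC-equivalence of the head. [folklore] -/
theorem ACEq.sumL_congr {x y : PIFormula 𝔽 X} (h : ACEq x y) (l : List (PIFormula 𝔽 X)) :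
    ACEq (sumL x l) (sumL y l) := by
  induction l generalizing x y with
  | nil => exact h
  | cons w ws ih => exact ih (h.add_congr (.refl w))

/-- Re-association: `x + (u + u₁ + ⋯) ≡ (x + u) + u₁ + ⋯`. [folklore] -/
theorem acEq_add_sumL (x u : PIFormula 𝔽 X) (us : List (PIFormula 𝔽 X)) :
    ACEq (.add x (sumL u us)) (sumL (.add x u) us) := by
  induction us generalizing u with
  | nil => exact .refl _
  | cons w ws ih => exact (ih (.add u w)).trans ((ACEq.add_assoc x u w).sumL_congr ws)

/-- `addArgs` is a nonempty list. [folklore] -/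
theorem exists_cons_of_addArgs (p : PIFormula 𝔽 X) : ∃ u us, addArgs p = u :: us := by
  cases h : addArgs p with
  | nil => have := one_le_length_addArgs p; simp [h] at this
  | cons u us => exact ⟨u, us, rfl⟩

/-- **Every formula is AC-equivalent to the left-nested sum of its flattened summands.**
[folklore] -/
theorem acEq_sumL_addArgs : ∀ (p u : PIFormula 𝔽 X) (us : List (PIFormula 𝔽 X)),
    addArgs p = u :: us → ACEq (sumL u us) p
  | .var x, u, us, h => by
    simp only [addArgs, List.cons.injEq] at h
    obtain ⟨rfl, rfl⟩ := h
    exact .refl _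
  | .const c, u, us, h => by
    simp only [addArgs, List.cons.injEq] at h
    obtain ⟨rfl, rfl⟩ := h
    exact .refl _
  | .mul p q, u, us, h => by
    simp only [addArgs, List.cons.injEq] at h
    obtain ⟨rfl, rfl⟩ := h
    exact .refl _
  | .add p q, u, us, h => by
    obtain ⟨u', us', hu⟩ := exists_cons_of_addArgs p
    obtain ⟨v, vs, hv⟩ := exists_cons_of_addArgs q
    rw [addArgs_add, hu, hv] at h
    simp only [List.cons_append, List.cons.injEq] at h
    obtain ⟨rfl, rfl⟩ := h
    rw [sumL_append]
    exact (acEq_add_sumL _ _ _).symm.trans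
      ((acEq_sumL_addArgs p _ _ hu).add_congr (acEq_sumL_addArgs q _ _ hv))

namespace ACClass

/-- `+` on AC-classes. [folklore] -/
def addC : ACClass 𝔽 X → ACClass 𝔽 X → ACClass 𝔽 X :=
  Quotient.map₂ PIFormula.add fun _ _ h₁ _ _ h₂ => ACEq.add_congr h₁ h₂

/-- `addC` on representatives. [folklore] -/
@[simp] theorem addC_mk (F G : PIFormula 𝔽 X) : addC (mk F) (mk G) = mk (.add F G) := rfl

/-- `addC` is commutative. [folklore] -/
theorem addC_comm (a b : ACClass 𝔽 X) : addC a b = addC b a := by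
  induction a using Quotient.inductionOn
  induction b using Quotient.inductionOn
  exact Quotient.sound (ACEq.add_comm _ _)

/-- `addC` is associative. [folklore] -/
theorem addC_assoc (a b c : ACClass 𝔽 X) : addC a (addC b c) = addC (addC a b) c := by
  induction a using Quotient.inductionOn
  induction b using Quotient.inductionOn
  induction c using Quotient.inductionOn
  exact Quotient.sound (ACEq.add_assoc _ _ _)

/-- Accumulating a sum of classes (`none` = the empty sum). [folklore] -/
def ofoldA : Option (ACClass 𝔽 X) → ACClass 𝔽 X → Option (ACClass 𝔽 X)
  | none, x => some x
  | some y, x => some (addC y x)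

/-- The accumulator is right-commutative, so the result is permutation invariant. [folklore] -/
instance ofoldA_rightCommutative : RightCommutative (ofoldA (𝔽 := 𝔽) (X := X)) := by
  refine ⟨fun z a b => ?_⟩
  rcases z with _ | z
  · change some (addC a b) = some (addC b a)
    rw [addC_comm]
  · change some (addC (addC z a) b) = some (addC (addC z b) a)
    rw [← addC_assoc, ← addC_assoc, addC_comm a b]

/-- The sum of a list of classes (`none` for the empty list). [folklore] -/
def sumC (l : List (ACClass 𝔽 X)) : Option (ACClass 𝔽 X) := l.foldl ofoldA none

/-- Accumulating from a class computes the class of the left-nested sum. [folklore] -/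
theorem foldl_ofoldA_some (v : PIFormula 𝔽 X) (us : List (PIFormula 𝔽 X)) :
    (us.map mk).foldl ofoldA (some (mk v)) = some (mk (sumL v us)) := by
  induction us generalizing v with
  | nil => rfl
  | cons w ws ih => exact ih (.add v w)

/-- The sum of the classes of a nonempty list is the class of its left-nested sum. [folklore] -/
theorem sumC_map_mk_cons (u : PIFormula 𝔽 X) (us : List (PIFormula 𝔽 X)) :
    sumC ((u :: us).map mk) = some (mk (sumL u us)) :=
  foldl_ofoldA_some u us

/-- The sum of a list of classes only depends on the multiset. [folklore] -/
theorem sumC_perm {l l' : List (ACClass 𝔽 X)} (h : l.Perm l') : sumC l = sumC l' :=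
  h.foldl_eq none

end ACClass

/-- Left-nested sums of lists with the same multiset of classes are AC-equivalent. [folklore] -/
theorem acEq_sumL_of_perm {u u' : PIFormula 𝔽 X} {us us' : List (PIFormula 𝔽 X)}
    (h : ((u :: us).map mk).Perm ((u' :: us').map mk)) : ACEq (sumL u us) (sumL u' us') := by
  have e := ACClass.sumC_perm h
  rw [ACClass.sumC_map_mk_cons, ACClass.sumC_map_mk_cons, Option.some.injEq] at e
  exact mk_eq_mk.1 e

/-- **A formula is determined modulo AC by the multiset of classes of its flattened summands.**
[folklore] -/
theorem acEq_of_addArgs_perm {p p' : PIFormula 𝔽 X}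
    (h : ((addArgs p).map mk).Perm ((addArgs p').map mk)) : ACEq p p' := by
  obtain ⟨u, us, hu⟩ := exists_cons_of_addArgs p
  obtain ⟨u', us', hu'⟩ := exists_cons_of_addArgs p'
  rw [hu, hu'] at h
  exact ((acEq_sumL_addArgs p u us hu).symm.trans (acEq_sumL_of_perm h)).trans
    (acEq_sumL_addArgs p' u' us' hu')

/-! ### Products -/

/-- The left-nested product `u · u₁ ⋯ u_k` of a nonempty list `u :: us`. [folklore] -/
def prodL (u : PIFormula 𝔽 X) (us : List (PIFormula 𝔽 X)) : PIFormula 𝔽 X := us.foldl .mul u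

/-- `prodL` of a singleton. [folklore] -/
@[simp] theorem prodL_nil (u : PIFormula 𝔽 X) : prodL u [] = u := rfl

/-- `prodL` unfolds one step. [folklore] -/
@[simp] theorem prodL_cons (u w : PIFormula 𝔽 X) (ws : List (PIFormula 𝔽 X)) :
    prodL u (w :: ws) = prodL (.mul u w) ws := rfl

/-- `prodL` over a concatenation. [folklore] -/
theorem prodL_append (u : PIFormula 𝔽 X) (us : List (PIFormula 𝔽 X)) (v : PIFormula 𝔽 X)
    (vs : List (PIFormula 𝔽 X)) : prodL u (us ++ v :: vs) = prodL (.mul (prodL u us) v) vs := by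
  simp only [prodL, List.foldl_append, List.foldl_cons]

/-- `prodL` respects AC-equivalence of the head. [folklore] -/
theorem ACEq.prodL_congr {x y : PIFormula 𝔽 X} (h : ACEq x y) (l : List (PIFormula 𝔽 X)) :
    ACEq (prodL x l) (prodL y l) := by
  induction l generalizing x y with
  | nil => exact h
  | cons w ws ih => exact ih (h.mul_congr (.refl w))

/-- Re-association: `x · (u · u₁ ⋯) ≡ (x · u) · u₁ ⋯`. [folklore] -/
theorem acEq_mul_prodL (x u : PIFormula 𝔽 X) (us : List (PIFormula 𝔽 X)) :
    ACEq (.mul x (prodL u us)) (prodL (.mul x u) us) := by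
  induction us generalizing u with
  | nil => exact .refl _
  | cons w ws ih => exact (ih (.mul u w)).trans ((ACEq.mul_assoc x u w).prodL_congr ws)

/-- `mulArgs` is a nonempty list. [folklore] -/
theorem exists_cons_of_mulArgs (p : PIFormula 𝔽 X) : ∃ u us, mulArgs p = u :: us := by
  cases h : mulArgs p with
  | nil => have := one_le_length_mulArgs p; simp [h] at this
  | cons u us => exact ⟨u, us, rfl⟩

/-- **Every formula is AC-equivalent to the left-nested product of its flattened factors.**
[folklore] -/
theorem acEq_prodL_mulArgs : ∀ (p u : PIFormula 𝔽 X) (us : List (PIFormula 𝔽 X)),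
    mulArgs p = u :: us → ACEq (prodL u us) p
  | .var x, u, us, h => by
    simp only [mulArgs, List.cons.injEq] at h
    obtain ⟨rfl, rfl⟩ := h
    exact .refl _
  | .const c, u, us, h => by
    simp only [mulArgs, List.cons.injEq] at h
    obtain ⟨rfl, rfl⟩ := h
    exact .refl _
  | .add p q, u, us, h => by
    simp only [mulArgs, List.cons.injEq] at h
    obtain ⟨rfl, rfl⟩ := h
    exact .refl _
  | .mul p q, u, us, h => by
    obtain ⟨u', us', hu⟩ := exists_cons_of_mulArgs p
    obtain ⟨v, vs, hv⟩ := exists_cons_of_mulArgs q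
    rw [mulArgs_mul, hu, hv] at h
    simp only [List.cons_append, List.cons.injEq] at h
    obtain ⟨rfl, rfl⟩ := h
    rw [prodL_append]
    exact (acEq_mul_prodL _ _ _).symm.trans
      ((acEq_prodL_mulArgs p _ _ hu).mul_congr (acEq_prodL_mulArgs q _ _ hv))

namespace ACClass

/-- `×` on AC-classes. [folklore] -/
def mulC : ACClass 𝔽 X → ACClass 𝔽 X → ACClass 𝔽 X :=
  Quotient.map₂ PIFormula.mul fun _ _ h₁ _ _ h₂ => ACEq.mul_congr h₁ h₂

/-- `mulC` on representatives. [folklore] -/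
@[simp] theorem mulC_mk (F G : PIFormula 𝔽 X) : mulC (mk F) (mk G) = mk (.mul F G) := rfl

/-- `mulC` is commutative. [folklore] -/
theorem mulC_comm (a b : ACClass 𝔽 X) : mulC a b = mulC b a := by
  induction a using Quotient.inductionOn
  induction b using Quotient.inductionOn
  exact Quotient.sound (ACEq.mul_comm _ _)

/-- `mulC` is associative. [folklore] -/
theorem mulC_assoc (a b c : ACClass 𝔽 X) : mulC a (mulC b c) = mulC (mulC a b) c := by
  induction a using Quotient.inductionOn
  induction b using Quotient.inductionOn
  induction c using Quotient.inductionOn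
  exact Quotient.sound (ACEq.mul_assoc _ _ _)

/-- Accumulating a product of classes (`none` = the empty product). [folklore] -/
def ofoldM : Option (ACClass 𝔽 X) → ACClass 𝔽 X → Option (ACClass 𝔽 X)
  | none, x => some x
  | some y, x => some (mulC y x)

/-- The accumulator is right-commutative. [folklore] -/
instance ofoldM_rightCommutative : RightCommutative (ofoldM (𝔽 := 𝔽) (X := X)) := by
  refine ⟨fun z a b => ?_⟩
  rcases z with _ | z
  · change some (mulC a b) = some (mulC b a)
    rw [mulC_comm]
  · change some (mulC (mulC z a) b) = some (mulC (mulC z b) a)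
    rw [← mulC_assoc, ← mulC_assoc, mulC_comm a b]

/-- The product of a list of classes (`none` for the empty list). [folklore] -/
def prodC (l : List (ACClass 𝔽 X)) : Option (ACClass 𝔽 X) := l.foldl ofoldM none

/-- Accumulating from a class computes the class of the left-nested product. [folklore] -/
theorem foldl_ofoldM_some (v : PIFormula 𝔽 X) (us : List (PIFormula 𝔽 X)) :
    (us.map mk).foldl ofoldM (some (mk v)) = some (mk (prodL v us)) := by
  induction us generalizing v with
  | nil => rfl
  | cons w ws ih => exact ih (.mul v w)

/-- The product of the classes of a nonempty list is the class of its left-nested product.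
[folklore] -/
theorem prodC_map_mk_cons (u : PIFormula 𝔽 X) (us : List (PIFormula 𝔽 X)) :
    prodC ((u :: us).map mk) = some (mk (prodL u us)) :=
  foldl_ofoldM_some u us

/-- The product of a list of classes only depends on the multiset. [folklore] -/
theorem prodC_perm {l l' : List (ACClass 𝔽 X)} (h : l.Perm l') : prodC l = prodC l' :=
  h.foldl_eq none

end ACClass

/-- Left-nested products of lists with the same multiset of classes are AC-equivalent. [folklore] -/
theorem acEq_prodL_of_perm {u u' : PIFormula 𝔽 X} {us us' : List (PIFormula 𝔽 X)}
    (h : ((u :: us).map mk).Perm ((u' :: us').map mk)) : ACEq (prodL u us) (prodL u' us') := by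
  have e := ACClass.prodC_perm h
  rw [ACClass.prodC_map_mk_cons, ACClass.prodC_map_mk_cons, Option.some.injEq] at e
  exact mk_eq_mk.1 e

/-- **A formula is determined modulo AC by the multiset of classes of its flattened factors.**
[folklore] -/
theorem acEq_of_mulArgs_perm {p p' : PIFormula 𝔽 X}
    (h : ((mulArgs p).map mk).Perm ((mulArgs p').map mk)) : ACEq p p' := by
  obtain ⟨u, us, hu⟩ := exists_cons_of_mulArgs p
  obtain ⟨u', us', hu'⟩ := exists_cons_of_mulArgs p'
  rw [hu, hu'] at h
  exact ((acEq_prodL_mulArgs p u us hu).symm.trans (acEq_prodL_of_perm h)).trans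
    (acEq_prodL_mulArgs p' u' us' hu')

end ACStability

open Literature.Computability.AlgebraicComplexity in
/-- **A sum is determined modulo AC by its flattened summands** (helper under stub S2″
`stub_proofsToACEquiv`, crux `RestorationQP`, rung S3⁗): two formulas over `ℂ` in the matrix variables
whose maximal `+`-chains at the root consist of AC-equivalent summands with the same multiplicities
are equal modulo associativity and commutativity. [folklore] -/
theorem proofsToACEquiv_aux_acSums : ∀ (n : ℕ) (F G : PIFormula ℂ (Fin n × Fin n)), ((ACStability.addArgs F).map ACStability.ACClass.mk).Perm ((ACStability.addArgs G).map ACStability.ACClass.mk) → ACStability.ACEq F G := by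
  intro n F G h
  exact ACStability.acEq_of_addArgs_perm h

end Summit.ValiantsHypothesis.ValiantsHypothesis.Theorems
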